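import Summits.Schanuel.Schanuel.Theses.RigidCore
import Literature.NumberTheory.Transcendental.ExpPointsExamples

/-!
# Rational jet forces a vanishing tail (stub `stub_rationalJetRunge`, Theorem R)

Line `cusp-germ-schneider-sparsity` for crux `RigidCore.SparsityTwo` (item stmt-Schanuel-0971),
branch "the polar jet is a RATIONAL polynomial `q(N)` in `N`" of the composition
`SparsityTwo_of_statements`.

What. If `q ∈ ℚ[X]`, `g` is analytic at `0` with `g 0 = 0`, `e ≥ 1`, and
`q(N) + g(N^{-1/e}) ∈ ℤ` for infinitely many `N : ℕ`, then `g` vanishes identically near `0`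
(the lead then contradicts this with the transcendence of the tail `g`).

Source. The idea card's "Runge remark" / First lemma; re-derived by the planner and the lead.
Elementary: clear denominators (`IsLocalization.integerNormalization` for `ℤ ⊂ ℚ`) to get
`b ≠ 0` in `ℤ` with `b · q(N) ∈ ℤ` for all `N`, so at a hit `b · g(N^{-1/e}) ∈ ℤ`; since
`N^{-1/e} → 0` and `g` is continuous at `0` with `g 0 = 0`, eventually `‖b · g(N^{-1/e})‖ < 1`,
so this integer is `0` and `g(N^{-1/e}) = 0` at every large hit; the hit set is infinite, so `g`
vanishes frequently along `𝓝[≠] 0`, and the identity theorem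
(`AnalyticAt.frequently_zero_iff_eventually_zero`) concludes.

Design. Mathlib only, no definitions. Two private helpers isolate the bookkeeping: denominator
clearing (`exists_int_mul_eval_eq`) and the abstract form of the argument for an arbitrary
sequence of sample points tending to `0` within `{0}ᶜ` (`eventually_zero_of_infinite_hits`); the
registered statement is the specialisation to the ray points `σ_N = (N^{1/e})⁻¹`
(`tendsto_rayPoint`). Junk: `N = 0` gives `σ_0 = 0⁻¹ = 0`, harmless since only large `N` are used.
-/

namespace Summit.Schanuel.Schanuel.Cruxes.SparsityTwo.CuspGermSchneiderSparsity

open Filter Topology Complex Polynomial Literature.NumberTheory.Transcendental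
open scoped Real

/-- Clearing denominators: for `q ∈ ℚ[X]` there are `b ∈ ℤ ∖ 0` and `P ∈ ℤ[X]` with
`b · q(N) = P(N)` in `ℂ` for every `N : ℕ`. -/
private theorem exists_int_mul_eval_eq (q : Polynomial ℚ) :
    ∃ b : ℤ, b ≠ 0 ∧ ∃ P : Polynomial ℤ, ∀ N : ℕ,
      (b : ℂ) * (q.map (algebraMap ℚ ℂ)).eval (N : ℂ) = ((P.eval (N : ℤ) : ℤ) : ℂ) := by
  obtain ⟨b, hb, hP⟩ := IsLocalization.integerNormalization_spec (nonZeroDivisors ℤ) q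
  refine ⟨b, nonZeroDivisors.ne_zero hb, IsLocalization.integerNormalization (nonZeroDivisors ℤ) q,
    fun N => ?_⟩
  have h1 : ((b • q).map (algebraMap ℚ ℂ)).eval (N : ℂ) =
      (b : ℂ) * (q.map (algebraMap ℚ ℂ)).eval (N : ℂ) := by
    rw [zsmul_eq_mul, Polynomial.map_mul, Polynomial.map_intCast, Polynomial.eval_mul,
      Polynomial.eval_intCast]
  rw [← h1, ← hP, Polynomial.map_map, Polynomial.eval_map, Polynomial.eval₂_at_natCast, eq_intCast]

/-- The abstract argument: if `g` is analytic at `0` with `g 0 = 0`, the sample points `t N` tend to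
`0` avoiding `0`, and `q(N) + g(t N) ∈ ℤ` for infinitely many `N` (`q ∈ ℚ[X]`), then `g ≡ 0`
near `0`. -/
private theorem eventually_zero_of_infinite_hits {q : Polynomial ℚ} {g : ℂ → ℂ} {t : ℕ → ℂ}
    (hg : AnalyticAt ℂ g 0) (hg0 : g 0 = 0) (ht : Tendsto t atTop (𝓝[≠] 0))
    (hinf : Set.Infinite {N : ℕ | ∃ L : ℤ, (q.map (algebraMap ℚ ℂ)).eval (N : ℂ) + g (t N) = L}) :
    ∀ᶠ z in 𝓝 (0 : ℂ), g z = 0 := by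
  have ht0 : Tendsto t atTop (𝓝 0) := ht.mono_right nhdsWithin_le_nhds
  -- clear denominators
  obtain ⟨b, hb, P, hP⟩ := exists_int_mul_eval_eq q
  -- `b * g (t N) → 0`
  have hbg : Tendsto (fun N => (b : ℂ) * g (t N)) atTop (𝓝 0) := by
    have h := hg.continuousAt.tendsto.comp ht0
    rw [hg0] at h
    simpa using h.const_mul (b : ℂ)
  have hsmall : ∀ᶠ N in atTop, ‖(b : ℂ) * g (t N)‖ < 1 := by
    have h := hbg.norm
    rw [norm_zero] at h
    exact h.eventually (gt_mem_nhds zero_lt_one)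
  -- at every large hit, `g (t N) = 0`
  have hzero : ∀ᶠ N : ℕ in atTop,
      (∃ L : ℤ, (q.map (algebraMap ℚ ℂ)).eval (N : ℂ) + g (t N) = L) → g (t N) = 0 := by
    filter_upwards [hsmall] with N hN hhit
    obtain ⟨L, hL⟩ := hhit
    have hM : (b : ℂ) * g (t N) = ((b * L - P.eval (N : ℤ) : ℤ) : ℂ) := by
      have h2 : (b : ℂ) * g (t N) = b * L - (b : ℂ) * (q.map (algebraMap ℚ ℂ)).eval (N : ℂ) := by
        rw [← hL]; ring
      rw [h2, hP N]; push_cast; ring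
    have hlt : |(b * L - P.eval (N : ℤ) : ℤ)| < 1 := by
      rw [hM, Complex.norm_intCast] at hN
      exact_mod_cast hN
    rw [Int.abs_lt_one_iff.mp hlt, Int.cast_zero] at hM
    exact (mul_eq_zero.mp hM).resolve_left (Int.cast_ne_zero.mpr hb)
  -- the hits are frequent along `atTop`, hence the zeros of `g` are frequent along `𝓝[≠] 0`
  have hfreq : ∃ᶠ N : ℕ in atTop,
      ∃ L : ℤ, (q.map (algebraMap ℚ ℂ)).eval (N : ℂ) + g (t N) = L :=
    Nat.frequently_atTop_iff_infinite.mpr hinf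
  have hfreq0 : ∃ᶠ z in 𝓝[≠] (0 : ℂ), g z = 0 := ht.frequently (hfreq.mp hzero)
  exact hg.frequently_zero_iff_eventually_zero.mp hfreq0

/-- The ray points `σ_N = (N^{1/e})⁻¹` (`e ≥ 1`) tend to `0` within `{0}ᶜ`. -/
private theorem tendsto_rayPoint {e : ℕ} (he : 0 < e) :
    Tendsto (fun N : ℕ => ((((N : ℝ) ^ ((e : ℝ)⁻¹) : ℝ) : ℂ))⁻¹) atTop (𝓝[≠] 0) := by
  have hpos : (0 : ℝ) < (e : ℝ)⁻¹ := inv_pos.mpr (by exact_mod_cast he)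
  have h1 : Tendsto (fun N : ℕ => (N : ℝ) ^ ((e : ℝ)⁻¹)) atTop atTop :=
    (tendsto_rpow_atTop hpos).comp tendsto_natCast_atTop_atTop
  have h2 : Tendsto (fun N : ℕ => ((((N : ℝ) ^ ((e : ℝ)⁻¹) : ℝ) : ℂ))⁻¹) atTop (𝓝 0) := by
    have h3 := (Complex.continuous_ofReal.tendsto 0).comp h1.inv_tendsto_atTop
    rw [Complex.ofReal_zero] at h3
    refine Tendsto.congr (fun N => ?_) h3
    simp only [Function.comp_apply, Pi.inv_apply, Complex.ofReal_inv]
  refine tendsto_nhdsWithin_iff.mpr ⟨h2, ?_⟩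
  filter_upwards [eventually_gt_atTop 0] with N hN
  exact inv_ne_zero
    (Complex.ofReal_ne_zero.mpr (Real.rpow_pos_of_pos (Nat.cast_pos.mpr hN) _).ne')

/-- **Theorem R** (rational jet ⇒ vanishing tail). If `e ≥ 1`, `q ∈ ℚ[X]`, `g` is analytic at `0`
with `g 0 = 0`, and `q(N) + g(N^{-1/e}) ∈ ℤ` for infinitely many `N : ℕ`, then `g = 0`
identically near `0`. -/
theorem stub_rationalJetRunge :
    ∀ (e : ℕ), 0 < e → ∀ (q : Polynomial ℚ) (g : ℂ → ℂ), AnalyticAt ℂ g 0 → g 0 = 0 →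
      Set.Infinite {N : ℕ | ∃ L : ℤ,
        (q.map (algebraMap ℚ ℂ)).eval (N : ℂ) + g ((((N : ℝ) ^ ((e : ℝ)⁻¹) : ℝ) : ℂ))⁻¹ = L} →
      ∀ᶠ z in 𝓝 (0 : ℂ), g z = 0 :=
  fun _e he _q _g hg hg0 hinf => eventually_zero_of_infinite_hits hg hg0 (tendsto_rayPoint he) hinf

end Summit.Schanuel.Schanuel.Cruxes.SparsityTwo.CuspGermSchneiderSparsity
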